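import Mathlib
import HarnessLib
import Summits.ValiantsHypothesis.ValiantsHypothesis.Theorems.MonotoneRestorationMonotoneRestorationQPNewtonProdPsum

/-!
# ValiantsHypothesis / MonotoneRestoration — `MonotoneRestorationQP`, line `Sketch`, stub D2

Support file for crux item `stmt-ValiantsHypothesis-15886`
(`Summit.ValiantsHypothesis.ValiantsHypothesis.Theses.MonotoneRestoration.MonotoneRestorationQP`),
line `Sketch`, stub `stub_commutingMatrices_newton` (Theorem δ, "commuting row scans restore with
polynomial symmetric size"): the ordered product `M 0 * M 1 * ⋯ * M (m-1)` of pairwise COMMUTING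
matrices over a commutative `ℚ`-algebra is computed SYMMETRICALLY by Newton's recursion in the
power-sum matrices `P_d = ∑ j, M j ^ d`:

  `E 0 = 1`,  `k • E k = ∑_{i<k} (-1)^i * E (k-1-i) * P_{i+1}`  (`1 ≤ k ≤ m`)  ⟹  `E m = ∏ M j`.

## Proof

* `CommutingMatricesNewton.natCast_mul_esymm_eq_sum_range` — Newton's identities in
  `MvPolynomial σ K` in the "range" indexing used by the recursion,
  `(n+1) e_{n+1} = ∑_{i ≤ n} (-1)^i e_{n-i} p_{i+1}`, a reindexing of Mathlib's
  `MvPolynomial.mul_esymm_eq_sum` (`k e_k = (-1)^{k+1} ∑_{a+b=k, a<k} (-1)^a e_a p_b`).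
* `CommutingMatricesNewton.eq_map_esymm_of_newtonRecursion` — for ANY (possibly noncommutative)
  `ℚ`-algebra `B` and `ℚ`-algebra map `φ : ℚ[X_0,…,X_{m-1}] → B` with `φ (X j) = M j`, a solution
  `E` of the recursion satisfies `E k = φ (e_k)` for `k ≤ m` (strong induction on `k`; `k` is
  invertible in `ℚ`).
* `CommutingMatricesNewton.newtonRecursion_prod` (D1, scalar case) — in a commutative `ℚ`-algebra,
  `E m = ∏ j, a j` (`φ = MvPolynomial.aeval a`, `e_m = ∏ X j`).
* `stub_commutingMatrices_newton` (D2) — for pairwise commuting matrices `M j` the subalgebra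
  `S = ℚ[M_0, …, M_{m-1}]` is commutative (`Algebra.isMulCommutative_adjoin`), so
  `φ = S.val ∘ MvPolynomial.aeval (j ↦ ⟨M j, _⟩)` is available, `E m = φ (∏ X j)`, and a ring map
  sends the product in the commutative polynomial ring to the ORDERED list product
  (`map_list_prod`, `List.prod_ofFn`).

## References

* I. G. Macdonald, *Symmetric Functions and Hall Polynomials*, 2nd ed., Oxford 1995, I.(2.11')
  (Newton's formulae).
-/

-- `Summit.ValiantsHypothesis.ValiantsHypothesis.…` is the tree's mandated single-conjunct layout
-- (Sub = Summit), so the duplicated namespace component is intended.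
set_option linter.dupNamespace false

noncomputable section

namespace Summit.ValiantsHypothesis.ValiantsHypothesis.Theorems

open MvPolynomial

namespace CommutingMatricesNewton

/-- **Newton's identities, range form**: in `MvPolynomial σ K`,
`(n + 1) • e_{n+1} = ∑_{i = 0}^{n} (-1)^i e_{n-i} p_{i+1}` (reindexing `a = (n - i, i + 1)` of
Mathlib's `MvPolynomial.mul_esymm_eq_sum`; the sign is `(-1)^{n+2} (-1)^{n-i} = (-1)^i`).
[folklore] -/
theorem natCast_mul_esymm_eq_sum_range (σ : Type*) [Fintype σ] [DecidableEq σ] (K : Type*)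
    [CommRing K] (n : ℕ) :
    ((n + 1 : ℕ) : MvPolynomial σ K) * esymm σ K (n + 1) =
      ∑ i ∈ Finset.range (n + 1), (-1) ^ i * esymm σ K (n - i) * psum σ K (i + 1) := by
  rw [MvPolynomial.mul_esymm_eq_sum, Finset.sum_filter, Finset.Nat.sum_antidiagonal_succ']
  dsimp only
  rw [if_neg (lt_irrefl _), zero_add, Finset.mul_sum, ← Finset.Nat.sum_antidiagonal_swap,
    Finset.Nat.sum_antidiagonal_eq_sum_range_succ_mk]
  refine Finset.sum_congr rfl fun i hi => ?_
  simp only [Prod.fst_swap, Prod.snd_swap]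
  rw [Finset.mem_range] at hi
  rw [if_pos (by omega)]
  obtain ⟨d, rfl⟩ := Nat.exists_eq_add_of_le (Nat.lt_succ_iff.mp hi)
  rw [Nat.add_sub_cancel_left]
  have h2 : ((-1 : MvPolynomial σ K) ^ d) * (-1) ^ d = 1 := by
    rw [← mul_pow, neg_one_mul, neg_neg, one_pow]
  linear_combination ((-1 : MvPolynomial σ K) ^ i * esymm σ K d * psum σ K (i + 1)) * h2

/-- **The recursion determines `E`**: for a `ℚ`-algebra map `φ : ℚ[X_0, …, X_{m-1}] → B` into a
possibly noncommutative `ℚ`-algebra `B` with `φ (X j) = M j`, every solution `E` of Newton's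
recursion `E 0 = 1`, `k • E k = ∑_{i<k} (-1)^i E (k-1-i) (∑ j, M j ^ (i+1))` (`1 ≤ k ≤ m`)
satisfies `E k = φ (e_k)` for all `k ≤ m` (strong induction on `k`, Newton's identities
`natCast_mul_esymm_eq_sum_range` pushed through `φ`, and cancellation of the unit `k ∈ ℚ`).
[folklore] -/
theorem eq_map_esymm_of_newtonRecursion {B : Type*} [Ring B] [Algebra ℚ B] {m : ℕ}
    (φ : MvPolynomial (Fin m) ℚ →ₐ[ℚ] B) (M : Fin m → B) (hM : ∀ j, φ (X j) = M j)
    (E : ℕ → B) (h0 : E 0 = 1)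
    (hrec : ∀ k : ℕ, 1 ≤ k → k ≤ m →
      (k : ℚ) • E k = ∑ i ∈ Finset.range k, (-1 : B) ^ i * E (k - 1 - i) * ∑ j, M j ^ (i + 1)) :
    ∀ k ≤ m, E k = φ (esymm (Fin m) ℚ k) := by
  intro k
  induction k using Nat.strong_induction_on with
  | _ k ih =>
    intro hkm
    cases k with
    | zero => rw [h0, esymm_zero, map_one]
    | succ n =>
      have hk0 : ((n + 1 : ℕ) : ℚ) ≠ 0 := Nat.cast_ne_zero.mpr (Nat.succ_ne_zero n)
      rw [← inv_smul_smul₀ hk0 (E (n + 1)), ← inv_smul_smul₀ hk0 (φ (esymm (Fin m) ℚ (n + 1)))]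
      congr 1
      rw [hrec (n + 1) (Nat.succ_le_succ (Nat.zero_le n)) hkm]
      calc ∑ i ∈ Finset.range (n + 1), (-1 : B) ^ i * E (n + 1 - 1 - i) * ∑ j, M j ^ (i + 1)
          = ∑ i ∈ Finset.range (n + 1),
              φ ((-1) ^ i * esymm (Fin m) ℚ (n - i) * psum (Fin m) ℚ (i + 1)) := by
            refine Finset.sum_congr rfl fun i hi => ?_
            rw [Finset.mem_range] at hi
            rw [Nat.add_sub_cancel, ih (n - i) (by omega) (by omega)]
            simp only [map_mul, map_pow, map_neg, map_one, psum, map_sum, hM]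
        _ = ((n + 1 : ℕ) : ℚ) • φ (esymm (Fin m) ℚ (n + 1)) := by
            rw [← map_sum, ← natCast_mul_esymm_eq_sum_range, map_mul, map_natCast,
              Nat.cast_smul_eq_nsmul, nsmul_eq_mul]

/-- **D1 — Newton's recursion computes the product (scalar case).** In a commutative `ℚ`-algebra
`A`, if `E 0 = 1` and `k • E k = ∑_{i<k} (-1)^i E (k-1-i) p_{i+1}` for `1 ≤ k ≤ m` with the
power sums `p_d = ∑ j, a j ^ d`, then `E m = ∏ j, a j` (`E k = e_k(a)` by
`eq_map_esymm_of_newtonRecursion` for `φ = MvPolynomial.aeval a`, and `e_m = ∏ j, X j`).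
[folklore] -/
theorem newtonRecursion_prod {A : Type*} [CommRing A] [Algebra ℚ A] {m : ℕ} (a : Fin m → A)
    (E : ℕ → A) (h0 : E 0 = 1)
    (hrec : ∀ k : ℕ, 1 ≤ k → k ≤ m →
      (k : ℚ) • E k = ∑ i ∈ Finset.range k, (-1 : A) ^ i * E (k - 1 - i) * ∑ j, a j ^ (i + 1)) :
    E m = ∏ j, a j := by
  rw [eq_map_esymm_of_newtonRecursion (MvPolynomial.aeval a) a (fun j => aeval_X a j) E h0 hrec
    m le_rfl, NewtonProdPsum.esymm_self_eq_prod_X, map_prod]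
  simp only [aeval_X]

end CommutingMatricesNewton

open scoped IsMulCommutative in
/-- **D2 — Newton's recursion computes the product of pairwise COMMUTING matrices** over a
commutative `ℚ`-algebra: if `E 0 = 1` and `k • E k = ∑_{i<k} (-1)^i E (k-1-i) P_{i+1}` for
`1 ≤ k ≤ m`, `P_d = ∑ j, M j ^ d`, then `E m = M 0 * M 1 * ⋯ * M (m-1)` (the subalgebra
`ℚ[M_0, …, M_{m-1}]` is commutative by `Algebra.isMulCommutative_adjoin`; there `E k = e_k(M)` by
`CommutingMatricesNewton.eq_map_esymm_of_newtonRecursion`, `e_m = ∏ j, X j`, and the inclusion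
into the matrix ring sends this product to the ordered list product). [folklore] -/
theorem stub_commutingMatrices_newton {R : Type} [CommRing R] [Algebra ℚ R] {w m : ℕ}
    (M : Fin m → Matrix (Fin w) (Fin w) R) (hcomm : ∀ i j, M i * M j = M j * M i)
    (E : ℕ → Matrix (Fin w) (Fin w) R) (h0 : E 0 = 1)
    (hrec : ∀ k : ℕ, 1 ≤ k → k ≤ m →
      (k : ℚ) • E k = ∑ i ∈ Finset.range k, (-1 : Matrix (Fin w) (Fin w) R) ^ i * E (k - 1 - i) *
        ∑ j, M j ^ (i + 1)) :
    E m = (List.ofFn M).prod := by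
  -- the subalgebra generated by the pairwise commuting `M j` is commutative
  haveI : IsMulCommutative (Algebra.adjoin ℚ (Set.range M)) :=
    Algebra.isMulCommutative_adjoin ℚ (by
      rintro _ ⟨i, rfl⟩ _ ⟨j, rfl⟩
      exact hcomm i j)
  -- evaluation `X j ↦ M j`, through the commutative subalgebra
  obtain ⟨φ, hφ⟩ : ∃ φ : MvPolynomial (Fin m) ℚ →ₐ[ℚ] Matrix (Fin w) (Fin w) R,
      ∀ j, φ (X j) = M j :=
    ⟨(Algebra.adjoin ℚ (Set.range M)).val.comp (MvPolynomial.aeval fun j : Fin m =>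
        (⟨M j, Algebra.subset_adjoin (Set.mem_range_self j)⟩ : Algebra.adjoin ℚ (Set.range M))),
      fun j => by simp only [AlgHom.coe_comp, Function.comp_apply, aeval_X, Subalgebra.coe_val]⟩
  rw [CommutingMatricesNewton.eq_map_esymm_of_newtonRecursion φ M hφ E h0 hrec m le_rfl,
    NewtonProdPsum.esymm_self_eq_prod_X, ← List.prod_ofFn, map_list_prod, List.map_ofFn]
  exact congrArg (fun f : Fin m → Matrix (Fin w) (Fin w) R => (List.ofFn f).prod) (funext hφ)

end Summit.ValiantsHypothesis.ValiantsHypothesis.Theorems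

end
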